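import Summits.BirchSwinnertonDyer.BirchSwinnertonDyer.Theorems.SchneiderFreeAdditiveX3LocalTowerTorsionLine
import Summits.BirchSwinnertonDyer.BirchSwinnertonDyer.Theorems.UniversalToricDescentKummerPow
import Summits.BirchSwinnertonDyer.BirchSwinnertonDyer.Theorems.UniversalToricDescentCofiniteDivisiblePart
import Literature.NumberTheory.EllipticCurves.SubgroupSelmerCocycleCriteriaProofs
import HarnessLib

/-!
# Level shifting in the local `ℤ_p`-tower: a class of `H¹(Γ_n ∩ D_v, M)` that dies on `ker κ ∩ D_v` dies on `Γ_m ∩ D_v` for `m ≫ 0`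
# (crux ♭T≤ stmt-BirchSwinnertonDyer-23042, line `sigmacongruence`, stub R1 `stub_relaxedImageCount`, brick (d) local step)

Route `UniversalToricDescent`, lead prover `bsd-wall-utd-p1` g18. THEOREMS ONLY (no definition, no named fact, no `sorry`);
`--supports stmt-BirchSwinnertonDyer-23042`. BSD is not proved by any of this.

For a `ℤ_p`-extension `κ` of a number field `K` (`Γ_n = κ⁻¹(pⁿℤ_p)`, `ker κ = ⋂_n Γ_n`), a finite place `v` (`D_v = decomp v`) and a
discrete `Γ_K`-module `M` with continuous orbit maps:

* (§1 is the tree's `SchneiderFreeAdditiveX3.exists_layerSubgroup_inf_subset`: an OPEN subset of `Γ_K` containing `D ∩ ker κ`,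
  `D` closed, contains `D ∩ Γ_n` for some `n` — compactness of `D`.)
* §2 **`exists_resOfLe_layer_inf_decomp_eq_zero`** — if `x ∈ H¹(Γ_n ∩ D_v, M)` restricts to `0` on `ker κ ∩ D_v`, then for some `n₁`
  and every `m ≥ n₁` it restricts to `0` on `Γ_m ∩ D_v`: a cocycle `φ` of `x` is `∂a` on `ker κ ∩ D_v`; the continuous map
  `f = φ − ∂a` into the discrete `M` vanishes on `ker κ ∩ D_v = ⋂_m (Γ_m ∩ D_v)`, hence on some `Γ_{n₁} ∩ D_v`, where `φ = ∂a`.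
  (The relaxed count road uses it for the dual Selmer classes: strictness at the places over `v`, tested on `K_{∞,η}`, is
  recovered at a deeper finite layer.)
* §3 `natCard_ker_torsionToPrimary_kerD_le` — over `ker(κ|_{D_v})` (the local group of `K_{∞,η}`), the kernel of
  `H¹(·, E[p^k]) → H¹(·, E[p^∞])` has AT MOST `#(E(K_{∞,η})[p^∞] / Div)` elements, `Div` the divisible part of `B = E(K_{∞,η})[p^∞]`
  (`…KummerPow`: the kernel is `B/p^k B`; `…CofiniteDivisiblePart`: `#(B/p^kB) ≤ #(B/Div)`) — a bound UNIFORM in `k`.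

References: [GreenbergLNM1716] §3 (Lemma 3.1 and its proof, pp. 85–87: passing between `K_∞` and the layers `K_n` locally);
[SerreGaloisCohomology1997] I.§2.2 (continuous cochains; `H¹` of a profinite group as a direct limit over open subgroups), I.§2.5.
-/

set_option linter.dupNamespace false
set_option autoImplicit false

noncomputable section
open scoped Classical
open CategoryTheory Field NumberField IsDedekindDomain Function
open Literature.NumberTheory.EllipticCurves Literature.NumberTheory.EllipticCurves.GreenbergSelmer
open Literature.NumberTheory.GaloisRepresentations

namespace Summit.BirchSwinnertonDyer.BirchSwinnertonDyer.Theorems.UniversalToricDescentRelaxedLocalLevelShift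

open Summit.BirchSwinnertonDyer.Rank1Residual.X11b.AcSelmer Literature.NumberTheory.EllipticCurves.CocycleCriteria
  Summit.BirchSwinnertonDyer.BirchSwinnertonDyer.Theorems.SchneiderFreeAdditiveX3

variable {K : Type} [Field K] [NumberField K] {p : ℕ} [Fact p.Prime] (κ : ZpExtension K p)
  {M : Type} [AddCommGroup M] [DistribMulAction (absoluteGaloisGroup K) M] [TopologicalSpace M] [DiscreteTopology M]

/-! ## §2 Level shifting for classes dying on `ker κ ∩ D_v` -/

/-- **Level shifting.** If `x ∈ H¹(Γ_n ∩ D_v, M)` restricts to zero on `ker κ ∩ D_v`, then there is `n₁` such that `x` restricts to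
zero on `Γ_m ∩ D_v` for every `m ≥ n₁` (with `Γ_m ∩ D_v ≤ Γ_n ∩ D_v`). [cite: GreenbergLNM1716, §3 (proof of Lemma 3.1, pp. 85–87)]
[cite: SerreGaloisCohomology1997, I.§2.2 (Prop. 8: `H¹` of a profinite group is the direct limit over open subgroups), I.§2.5] -/
theorem exists_resOfLe_layer_inf_decomp_eq_zero (hcont : ∀ m : M, Continuous fun g : absoluteGaloisGroup K ↦ g • m)
    (v : HeightOneSpectrum (𝓞 K)) (n : ℕ) (x : subgroupH1 (κ.layerSubgroup n ⊓ decomp v) M)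
    (hx : resOfLe M (inf_le_inf_right (decomp v) (κ.kerSubgroup_le_layerSubgroup n)) x = 0) :
    ∃ n₁ : ℕ, ∀ m : ℕ, n₁ ≤ m → ∀ h : κ.layerSubgroup m ⊓ decomp v ≤ κ.layerSubgroup n ⊓ decomp v, resOfLe M h x = 0 := by
  classical
  obtain ⟨φ, rfl⟩ := oneCocycleClass_surjective _ x
  obtain ⟨a, ha⟩ := (CocycleCriteria.resOfLe_oneCocycleClass_eq_zero_iff _ φ).mp hx
  -- the adjusted continuous map `f = φ - ∂a` on `P = Γ_n ∩ D_v`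
  let f : ↥(κ.layerSubgroup n ⊓ decomp v) → M := fun g ↦ φ.1 g - ((g : absoluteGaloisGroup K) • a - a)
  have hf_ker : ∀ g : ↥(κ.layerSubgroup n ⊓ decomp v), (g : absoluteGaloisGroup K) ∈ κ.kerSubgroup → f g = 0 := by
    intro g hg
    have e := ha ⟨g, Subgroup.mem_inf.mpr ⟨hg, (Subgroup.mem_inf.mp g.2).2⟩⟩
    have e' : (Subgroup.inclusion (inf_le_inf_right (decomp v) (κ.kerSubgroup_le_layerSubgroup n))
        ⟨g, Subgroup.mem_inf.mpr ⟨hg, (Subgroup.mem_inf.mp g.2).2⟩⟩ : ↥(κ.layerSubgroup n ⊓ decomp v)) = g :=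
      Subtype.ext (Subgroup.coe_inclusion _ _)
    rw [e'] at e
    change φ.1 g - ((g : absoluteGaloisGroup K) • a - a) = 0
    rw [e, sub_self]
  have hf_cont : Continuous f :=
    φ.1.continuous.sub (((hcont a).comp continuous_subtype_val).sub continuous_const)
  -- the open set `{f = 0}` of `P`, extended to an open set of `Γ_K`
  have hopen : IsOpen {g : ↥(κ.layerSubgroup n ⊓ decomp v) | f g = 0} :=
    (isOpen_discrete ({0} : Set M)).preimage hf_cont
  obtain ⟨t, ht, hft⟩ := isOpen_induced_iff.mp hopen
  have hPclosed : IsClosed ((κ.layerSubgroup n ⊓ decomp v : Subgroup (absoluteGaloisGroup K)) : Set (absoluteGaloisGroup K)) := by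
    rw [Subgroup.coe_inf]
    exact ((κ.layerSubgroup n).isClosed_of_isOpen (κ.isOpen_layerSubgroup n)).inter (isClosed_decomp v)
  obtain ⟨n₁, hn₁⟩ := exists_layerSubgroup_inf_subset κ (decomp v) (isClosed_decomp v) (ht.union hPclosed.isOpen_compl)
    (fun g hg ↦ by
      obtain ⟨hgD, hgker⟩ := Subgroup.mem_inf.mp hg
      have hgP : g ∈ κ.layerSubgroup n ⊓ decomp v := Subgroup.mem_inf.mpr ⟨κ.kerSubgroup_le_layerSubgroup n hgker, hgD⟩
      have h0 : (⟨g, hgP⟩ : ↥(κ.layerSubgroup n ⊓ decomp v)) ∈ {g | f g = 0} := hf_ker ⟨g, hgP⟩ hgker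
      rw [← hft] at h0
      exact Or.inl h0)
  refine ⟨n₁, fun m hm h ↦ ?_⟩
  rw [CocycleCriteria.resOfLe_oneCocycleClass_eq_zero_iff]
  refine ⟨a, fun l ↦ ?_⟩
  -- `f` vanishes at `l ∈ Γ_m ∩ D_v ⊆ Γ_{n₁} ∩ D_v`
  have hl : ((l : absoluteGaloisGroup K)) ∈ decomp v ⊓ κ.layerSubgroup n₁ :=
    Subgroup.mem_inf.mpr ⟨(Subgroup.mem_inf.mp l.2).2, κ.layerSubgroup_antitone hm (Subgroup.mem_inf.mp l.2).1⟩
  have hlO := hn₁ _ hl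
  have hlP : (l : absoluteGaloisGroup K) ∈ ((κ.layerSubgroup n ⊓ decomp v : Subgroup (absoluteGaloisGroup K)) :
      Set (absoluteGaloisGroup K)) := h l.2
  rcases hlO with hlt | hlc
  · have hval : ((Subgroup.inclusion h l : ↥(κ.layerSubgroup n ⊓ decomp v)) : absoluteGaloisGroup K) =
        (l : absoluteGaloisGroup K) := Subgroup.coe_inclusion h l
    have hmem : (Subgroup.inclusion h l) ∈ Subtype.val ⁻¹' t := by
      rw [Set.mem_preimage, hval]
      exact hlt
    rw [hft] at hmem
    have h0 : f (Subgroup.inclusion h l) = 0 := hmem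
    have h0' : φ.1 (Subgroup.inclusion h l) =
        ((Subgroup.inclusion h l : ↥(κ.layerSubgroup n ⊓ decomp v)) : absoluteGaloisGroup K) • a - a := sub_eq_zero.mp h0
    rw [h0', hval]
  · exact absurd hlP hlc

/-! ## §3 The level-`p^k` Kummer kernel over `K_{∞,η}` is bounded uniformly in `k` -/

section KummerKernel

variable (W : WeierstrassCurve K) [W.IsElliptic] (v : HeightOneSpectrum (𝓞 K))

open Summit.BirchSwinnertonDyer.Rank1Residual.X11b.Coinv
  Summit.BirchSwinnertonDyer.BirchSwinnertonDyer.Theorems.UniversalToricDescentKummerPow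
  Summit.BirchSwinnertonDyer.BirchSwinnertonDyer.Theorems.UniversalToricDescentCofiniteDivisiblePart

omit [W.IsElliptic] in
/-- `B = E[p^∞]^{ker(κ|D_v)}` is `p`-primary torsion. [cite: SilvermanAEC2009, Cor. III.6.4] -/
theorem exists_pow_smul_fixedPoints_kerD_eq_zero
    (b : FixedPoints.addSubgroup (kerD κ v) (W.geomPrimaryTorsion p)) : ∃ n : ℕ, p ^ n • b = 0 := by
  obtain ⟨n, hn⟩ := (AddCommGroup.mem_primaryComponent).mp (b.1).2
  refine ⟨n, Subtype.ext (Subtype.ext ?_)⟩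
  rw [AddSubgroupClass.coe_nsmul, AddSubgroupClass.coe_nsmul, hn]
  rfl

/-- `B = E[p^∞]^{ker(κ|D_v)}` has finite `p`-torsion (inside `E[p]`). [cite: SilvermanAEC2009, Cor. III.6.4] -/
theorem finite_setOf_fixedPoints_kerD_smul_eq_zero :
    Set.Finite {b : FixedPoints.addSubgroup (kerD κ v) (W.geomPrimaryTorsion p) | p • b = 0} := by
  have hfin := finite_setOf_geomPrimaryTorsion_pow_smul_eq_zero (p := p) W (Fact.out : p.Prime).ne_zero 1
  rw [pow_one] at hfin
  let f : {b : FixedPoints.addSubgroup (kerD κ v) (W.geomPrimaryTorsion p) | p • b = 0} →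
      {m : W.geomPrimaryTorsion p | p • m = 0} :=
    fun b ↦ ⟨(b.1 : W.geomPrimaryTorsion p), by
      have h := b.2
      simp only [Set.mem_setOf_eq] at h ⊢
      rw [← AddSubgroupClass.coe_nsmul, h]
      rfl⟩
  have hf : Function.Injective f := fun a b h ↦
    Subtype.ext (Subtype.ext (congrArg (fun x : {m : W.geomPrimaryTorsion p | p • m = 0} ↦ (x : W.geomPrimaryTorsion p)) h))
  haveI := hfin.to_subtype
  exact Set.finite_coe_iff.mp (Finite.of_injective f hf)

/-- **`#ker(H¹(ker κ|_{D_v}, E[p^k]) → H¹(ker κ|_{D_v}, E[p^∞])) ≤ #(E(K_{∞,η})[p^∞] / Div)`**, `Div` the divisible part of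
`B = E(K_{∞,η})[p^∞] = E[p^∞]^{ker(κ|D_v)}` (any subgroup with the divisible-part properties of `…CofiniteDivisiblePart.exists_divisiblePart`):
the kernel is `B/p^kB` (`…KummerPow.natCard_ker_kummerPow_eq_natCard_quotient`) and `#(B/p^kB) ≤ #(B/Div)` for every `k`
(`…CofiniteDivisiblePart.natCard_quotient_nsmul_range_le`). [cite: GreenbergLNM1716, §3 proof of Lemma 3.1 (p. 86), §5 p. 114] -/
theorem natCard_ker_torsionToPrimary_kerD_le {D : AddSubgroup (FixedPoints.addSubgroup (kerD κ v) (W.geomPrimaryTorsion p))}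
    (hDmem : ∀ b, b ∈ D ↔ ∀ k : ℕ, ∃ c, p ^ k • c = b) (hDdiv : ∀ d ∈ D, ∃ d' ∈ D, p • d' = d)
    [Finite (FixedPoints.addSubgroup (kerD κ v) (W.geomPrimaryTorsion p) ⧸ D)] (k : ℕ) :
    Nat.card ((resH1Hom (ContinuousMonoidHom.id (kerD κ v))
        (AddSubgroup.inclusion (Literature.Barriers.BirchSwinnertonDyer.geomTorsion_pow_le_geomPrimaryTorsion W p k))
        (fun _ _ ↦ rfl) :
          subgroupH1 (kerD κ v) (W.geomTorsion ((p ^ k : ℕ) : ℤ)) →+ subgroupH1 (kerD κ v) (W.geomPrimaryTorsion p)).ker) ≤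
      Nat.card (FixedPoints.addSubgroup (kerD κ v) (W.geomPrimaryTorsion p) ⧸ D) := by
  rw [natCard_ker_kummerPow_eq_natCard_quotient W p (kerD κ v) k]
  have h := (natCard_quotient_nsmul_range_le (Fact.out : p.Prime) (exists_pow_smul_fixedPoints_kerD_eq_zero κ W v)
    (finite_setOf_fixedPoints_kerD_smul_eq_zero κ W v) hDmem hDdiv k).2
  have e : (DistribSMul.toAddMonoidHom (FixedPoints.addSubgroup (kerD κ v) (W.geomPrimaryTorsion p)) (p ^ k)).range =
      (nsmulAddMonoidHom (α := FixedPoints.addSubgroup (kerD κ v) (W.geomPrimaryTorsion p)) (p ^ k)).range :=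
    congrArg AddMonoidHom.range (AddMonoidHom.ext fun _ ↦ rfl)
  rw [e]
  exact h

end KummerKernel

end Summit.BirchSwinnertonDyer.BirchSwinnertonDyer.Theorems.UniversalToricDescentRelaxedLocalLevelShift

end
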